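import Mathlib.Geometry.Manifold.PartitionOfUnity
import Mathlib.Analysis.SpecialFunctions.SmoothTransition
import Literature.Analysis.Convexity.AnisotropicPerimeterUnion
import Literature.Analysis.Convexity.AnisotropicPerimeterLowerSemicontinuity
import HarnessLib

/-!
# Additivity of the anisotropic perimeter over separated sets

Topic `Literature/Analysis/Convexity`; namespace `Literature.Analysis.Convexity`. Companion of
`AnisotropicPerimeter.lean` (`anisotropicPerimeter K A = sup {∫_A div φ : φ ∈ C¹_c(V; V), φ(x) ∈ K}`,
Maggi (20.2)) and of `AnisotropicPerimeterUnion.lean` (subadditivity `P_K(A ∪ B) ≤ P_K(A) + P_K(B)`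
over disjoint unions).

For a CONVEX constraint body `K ∋ 0` and measurable sets `A, B` that are SEPARATED — by a `C¹`
cutoff `θ : V → [0, 1]` equal to `1` near every point of `A` and to `0` near every point of `B`; in
particular by a slab `{a < ⟪x, m⟫ < b}` or by a positive distance — the `K`-perimeter is ADDITIVE:

  `P_K(A ∪ B) = P_K(A) + P_K(B)`.

Proof (elementary, no structure theory): given admissible fields `φ₁, φ₂` the glued field
`θ φ₁ + (1 − θ) φ₂` is admissible (`K` convex), equals `φ₁` near `A` and `φ₂` near `B`, so its
divergence integrates over `A ∪ B` to `∫_A div φ₁ + ∫_B div φ₂`; the suprema add.  (The printed road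
is Maggi's Theorem 16.3 (16.12), `P(E ∪ F; G) = P(E; F⁽⁰⁾ ∩ G) + P(F; E⁽⁰⁾ ∩ G) + Hⁿ⁻¹({ν_E = ν_F} ∩ G)`,
whose last term is empty for separated sets; here the special case is proved directly from (20.2).)
In the vocabulary of the venture `Summits/Ventures/Crystal3D` (crux `PolycrystalWulffBound`) this says
the interface term `ι_K(A, B) = (P_K(A) + P_K(B) − P_K(A ∪ B))/2` of two grains at positive distance
VANISHES — the bookkeeping behind "padding a texture with far-away grains" and behind the lamellar
(slab-by-slab) decompositions.

## References
* F. Maggi, *Sets of Finite Perimeter and Geometric Variational Problems*, CUP 2012, (20.2) p. 258,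
  Theorem 16.3 (16.12). [`Maggi2012`]

## Contents (all PROVED; no definitions, no named facts)
* `fieldDivergence_congr_of_eventuallyEq`, `fieldDivergence_zero` — plumbing;
* `contDiff_glue`, `hasCompactSupport_glue`, `glue_mem` — the glued field is admissible;
* `setIntegral_fieldDivergence_glue` — `∫_{A ∪ B} div(θφ₁ + (1−θ)φ₂) = ∫_A div φ₁ + ∫_B div φ₂`;
* `anisotropicPerimeter_union_eq_add_of_cutoff` — additivity given a separating `C¹` cutoff;
* `anisotropicPerimeter_union_eq_add_of_slab` — `A ⊆ {⟪x,m⟫ ≤ a}`, `B ⊆ {b ≤ ⟪x,m⟫}`, `a < b`;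
* `exists_contDiff_cutoff_of_le_dist`, `anisotropicPerimeter_union_eq_add_of_le_dist` — sets at
  distance `≥ δ > 0` (smooth Urysohn lemma on `V` regarded as a manifold);
* `perimeter_union_eq_add_of_le_dist` — the isotropic case (`K` = closed unit ball);
* `exists_contDiff_zero_one_nhdsSet`, `ofReal_add_ofReal_le_anisotropicPerimeter_union`,
  `anisotropicPerimeter_add_le_union`, `anisotropicPerimeter_union_of_disjoint_closure`,
  `anisotropicPerimeter_add_sub_union_eq_zero`, `perimeter_union_of_disjoint_closure` — the same
  under the hypothesis `Disjoint (closure A) (closure B)` (interface of the cell's literature seat,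
  crystal3d-full lit g8, p528312, restored verbatim after the two same-target submissions raced);
* `anisotropicPerimeter_union_eq_add_of_disjoint_closure`, `perimeter_union_eq_add_of_disjoint_closure`,
  `anisotropicPerimeter_eq_iSup_tsupport_subset` (LOCALITY: the supremum may be taken over fields
  supported in any open `U ⊇ closure A`) — the names of lit g8's p529135, likewise restored.
-/

noncomputable section

open MeasureTheory Set Filter Function Metric
open scoped ENNReal Topology Pointwise Manifold ContDiff RealInnerProductSpace

namespace Literature.Analysis.Convexity

open Literature.MathematicalPhysics.StatisticalMechanics (fieldDivergence perimeter)

variable {V : Type*} [NormedAddCommGroup V] [InnerProductSpace ℝ V] [FiniteDimensional ℝ V]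
  [MeasurableSpace V] [BorelSpace V]

/-! ### Plumbing: locality of the divergence, the zero field -/

omit [FiniteDimensional ℝ V] [MeasurableSpace V] [BorelSpace V] in
/-- The divergence at `x` only depends on the germ of the field at `x`.
[cite: Maggi2012, (20.2) p. 258 — plumbing] -/
theorem fieldDivergence_congr_of_eventuallyEq {φ ψ : V → V} {x : V} (h : φ =ᶠ[𝓝 x] ψ) :
    fieldDivergence φ x = fieldDivergence ψ x := by
  unfold fieldDivergence
  rw [h.fderiv_eq]

omit [FiniteDimensional ℝ V] [MeasurableSpace V] [BorelSpace V] in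
/-- The zero field has zero divergence. [cite: Maggi2012, (20.2) p. 258 — plumbing] -/
theorem fieldDivergence_zero (x : V) : fieldDivergence (0 : V → V) x = 0 := by
  unfold fieldDivergence
  have h : fderiv ℝ (0 : V → V) x = 0 := by
    show fderiv ℝ (fun _ : V => (0 : V)) x = 0
    exact (hasFDerivAt_const (0 : V) x).fderiv
  rw [h, ContinuousLinearMap.toLinearMap_zero, map_zero]

/-! ### Gluing two admissible fields along a `C¹` cutoff -/

omit [FiniteDimensional ℝ V] [MeasurableSpace V] [BorelSpace V] in
/-- The glued field `θ φ₁ + (1 − θ) φ₂` is `C¹`. [cite: Maggi2012, (20.2) p. 258 — plumbing] -/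
theorem contDiff_glue {φ₁ φ₂ : V → V} {θ : V → ℝ} (h₁ : ContDiff ℝ 1 φ₁) (h₂ : ContDiff ℝ 1 φ₂)
    (hθ : ContDiff ℝ 1 θ) : ContDiff ℝ 1 (fun x => θ x • φ₁ x + (1 - θ x) • φ₂ x) :=
  (hθ.smul h₁).add ((contDiff_const.sub hθ).smul h₂)

omit [InnerProductSpace ℝ V] [FiniteDimensional ℝ V] [MeasurableSpace V] [BorelSpace V] in
/-- The glued field `θ φ₁ + (1 − θ) φ₂` has compact support. [cite: Maggi2012, (20.2) p. 258 —
plumbing] -/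
theorem hasCompactSupport_glue [NormedSpace ℝ V] {φ₁ φ₂ : V → V} (θ : V → ℝ)
    (h₁ : HasCompactSupport φ₁) (h₂ : HasCompactSupport φ₂) :
    HasCompactSupport (fun x => θ x • φ₁ x + (1 - θ x) • φ₂ x) :=
  (h₁.smul_left (f := θ)).add (h₂.smul_left (f := fun x => 1 - θ x))

omit [FiniteDimensional ℝ V] [MeasurableSpace V] [BorelSpace V] in
/-- The glued field `θ φ₁ + (1 − θ) φ₂` takes values in the CONVEX body `K` when `φ₁, φ₂` do and
`0 ≤ θ ≤ 1`. [cite: Maggi2012, (20.2) p. 258 — plumbing] -/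
theorem glue_mem {K : Set V} (hK : Convex ℝ K) {φ₁ φ₂ : V → V} {θ : V → ℝ}
    (h₁ : ∀ x, φ₁ x ∈ K) (h₂ : ∀ x, φ₂ x ∈ K) (hθ01 : ∀ x, θ x ∈ Icc (0 : ℝ) 1) (x : V) :
    θ x • φ₁ x + (1 - θ x) • φ₂ x ∈ K :=
  hK (h₁ x) (h₂ x) (hθ01 x).1 (sub_nonneg.2 (hθ01 x).2) (by ring)

omit [InnerProductSpace ℝ V] [FiniteDimensional ℝ V] [MeasurableSpace V] [BorelSpace V] in
/-- A cutoff equal to `1` near `A` and to `0` near `B` forces `A` and `B` to be disjoint.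
[cite: Maggi2012, (20.2) p. 258 — plumbing] -/
theorem disjoint_of_cutoff {A B : Set V} {θ : V → ℝ} (hθA : ∀ x ∈ A, ∀ᶠ y in 𝓝 x, θ y = 1)
    (hθB : ∀ x ∈ B, ∀ᶠ y in 𝓝 x, θ y = 0) : Disjoint A B := by
  rw [Set.disjoint_left]
  intro x hxA hxB
  have h1 : θ x = 1 := (hθA x hxA).self_of_nhds
  have h0 : θ x = 0 := (hθB x hxB).self_of_nhds
  rw [h0] at h1
  exact zero_ne_one h1

/-- **Gluing identity.** If `θ = 1` near every point of `A` and `θ = 0` near every point of `B`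
(`A, B` measurable), then for `C¹_c` fields `φ₁, φ₂`
`∫_{A ∪ B} div (θ φ₁ + (1 − θ) φ₂) = ∫_A div φ₁ + ∫_B div φ₂`.
[cite: Maggi2012, (20.2) p. 258; Theorem 16.3 (16.12)] -/
theorem setIntegral_fieldDivergence_glue {A B : Set V} (hA : MeasurableSet A) (hB : MeasurableSet B)
    {φ₁ φ₂ : V → V} (h₁ : ContDiff ℝ 1 φ₁) (hc₁ : HasCompactSupport φ₁) (h₂ : ContDiff ℝ 1 φ₂)
    (hc₂ : HasCompactSupport φ₂) {θ : V → ℝ} (hθ : ContDiff ℝ 1 θ)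
    (hθA : ∀ x ∈ A, ∀ᶠ y in 𝓝 x, θ y = 1) (hθB : ∀ x ∈ B, ∀ᶠ y in 𝓝 x, θ y = 0) :
    ∫ x in A ∪ B, fieldDivergence (fun x => θ x • φ₁ x + (1 - θ x) • φ₂ x) x =
      (∫ x in A, fieldDivergence φ₁ x) + ∫ x in B, fieldDivergence φ₂ x := by
  set φ : V → V := fun x => θ x • φ₁ x + (1 - θ x) • φ₂ x with hφ
  have hAB : Disjoint A B := disjoint_of_cutoff hθA hθB
  have hint : Integrable (fieldDivergence φ) volume :=
    (continuous_fieldDivergence (contDiff_glue h₁ h₂ hθ)).integrable_of_hasCompactSupport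
      (hasCompactSupport_fieldDivergence' (hasCompactSupport_glue θ hc₁ hc₂))
  rw [setIntegral_union hAB hB hint.integrableOn hint.integrableOn]
  congr 1
  · refine setIntegral_congr_fun hA fun x hx => ?_
    apply fieldDivergence_congr_of_eventuallyEq
    filter_upwards [hθA x hx] with y hy
    simp [hφ, hy]
  · refine setIntegral_congr_fun hB fun x hx => ?_
    apply fieldDivergence_congr_of_eventuallyEq
    filter_upwards [hθB x hx] with y hy
    simp [hφ, hy]

/-! ### Additivity over separated sets -/

/-- **Additivity of the `K`-perimeter over sets separated by a cutoff.** Let `K` be convex with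
`0 ∈ K`, `A, B` measurable, and `θ ∈ C¹(V; [0, 1])` with `θ = 1` near every point of `A` and `θ = 0`
near every point of `B`. Then `P_K(A ∪ B) = P_K(A) + P_K(B)`, i.e. the interface term
`ι_K(A, B) = 0`. (`≤` is subadditivity; `≥`: glue near-optimal fields for `A` and for `B`.)
[cite: Maggi2012, Theorem 16.3 (16.12); (20.2) p. 258] -/
theorem anisotropicPerimeter_union_eq_add_of_cutoff {K : Set V} (hK : Convex ℝ K)
    (h0 : (0 : V) ∈ K) {A B : Set V} (hA : MeasurableSet A) (hB : MeasurableSet B) {θ : V → ℝ}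
    (hθ : ContDiff ℝ 1 θ) (hθ01 : ∀ x, θ x ∈ Icc (0 : ℝ) 1)
    (hθA : ∀ x ∈ A, ∀ᶠ y in 𝓝 x, θ y = 1) (hθB : ∀ x ∈ B, ∀ᶠ y in 𝓝 x, θ y = 0) :
    anisotropicPerimeter K (A ∪ B) = anisotropicPerimeter K A + anisotropicPerimeter K B := by
  have hAB : Disjoint A B := disjoint_of_cutoff hθA hθB
  refine le_antisymm (anisotropicPerimeter_union_le K hB hAB) ?_
  -- the zero field is admissible
  have hz : ContDiff ℝ 1 (0 : V → V) ∧ HasCompactSupport (0 : V → V) ∧ ∀ x, (0 : V → V) x ∈ K :=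
    ⟨contDiff_const, HasCompactSupport.zero, fun _ => h0⟩
  -- glued fields
  have H : ∀ φ₁ : V → V, (ContDiff ℝ 1 φ₁ ∧ HasCompactSupport φ₁ ∧ ∀ x, φ₁ x ∈ K) →
      ∀ φ₂ : V → V, (ContDiff ℝ 1 φ₂ ∧ HasCompactSupport φ₂ ∧ ∀ x, φ₂ x ∈ K) →
      ENNReal.ofReal ((∫ x in A, fieldDivergence φ₁ x) + ∫ x in B, fieldDivergence φ₂ x) ≤
        anisotropicPerimeter K (A ∪ B) := by
    intro φ₁ h₁ φ₂ h₂
    rw [← setIntegral_fieldDivergence_glue hA hB h₁.1 h₁.2.1 h₂.1 h₂.2.1 hθ hθA hθB]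
    exact le_anisotropicPerimeter (contDiff_glue h₁.1 h₂.1 hθ)
      (hasCompactSupport_glue θ h₁.2.1 h₂.2.1) (glue_mem hK h₁.2.2 h₂.2.2 hθ01)
  -- positive parts
  have key : ∀ φ₁ : V → V, (ContDiff ℝ 1 φ₁ ∧ HasCompactSupport φ₁ ∧ ∀ x, φ₁ x ∈ K) →
      ∀ φ₂ : V → V, (ContDiff ℝ 1 φ₂ ∧ HasCompactSupport φ₂ ∧ ∀ x, φ₂ x ∈ K) →
      ENNReal.ofReal (∫ x in A, fieldDivergence φ₁ x) +
          ENNReal.ofReal (∫ x in B, fieldDivergence φ₂ x) ≤ anisotropicPerimeter K (A ∪ B) := by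
    intro φ₁ h₁ φ₂ h₂
    have hzA : ∫ x in A, fieldDivergence (0 : V → V) x = 0 := by
      simp [fieldDivergence_zero]
    have hzB : ∫ x in B, fieldDivergence (0 : V → V) x = 0 := by
      simp [fieldDivergence_zero]
    rcases le_total 0 (∫ x in A, fieldDivergence φ₁ x) with ha | ha <;>
      rcases le_total 0 (∫ x in B, fieldDivergence φ₂ x) with hb | hb
    · rw [← ENNReal.ofReal_add ha hb]
      exact H φ₁ h₁ φ₂ h₂
    · rw [ENNReal.ofReal_of_nonpos hb, add_zero]
      simpa [hzB] using H φ₁ h₁ 0 hz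
    · rw [ENNReal.ofReal_of_nonpos ha, zero_add]
      simpa [hzA] using H 0 hz φ₂ h₂
    · rw [ENNReal.ofReal_of_nonpos ha, ENNReal.ofReal_of_nonpos hb, zero_add]
      exact zero_le
  unfold anisotropicPerimeter
  exact ENNReal.biSup_add_biSup_le' ⟨0, hz⟩ ⟨0, hz⟩ key

/-- **Additivity of the `K`-perimeter over sets separated by a slab.** If `A ⊆ {⟪x, m⟫ ≤ a}` and
`B ⊆ {b ≤ ⟪x, m⟫}` with `a < b` (measurable `A, B`, convex `K ∋ 0`), then
`P_K(A ∪ B) = P_K(A) + P_K(B)`. The cutoff is `θ(x) = smoothTransition((b' − ⟪x, m⟫)/(b' − a'))`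
with `a < a' < b' < b`. [cite: Maggi2012, Theorem 16.3 (16.12); (20.2) p. 258] -/
theorem anisotropicPerimeter_union_eq_add_of_slab {K : Set V} (hK : Convex ℝ K) (h0 : (0 : V) ∈ K)
    {A B : Set V} (hA : MeasurableSet A) (hB : MeasurableSet B) (m : V) {a b : ℝ} (hab : a < b)
    (hAa : ∀ x ∈ A, ⟪x, m⟫ ≤ a) (hBb : ∀ x ∈ B, b ≤ ⟪x, m⟫) :
    anisotropicPerimeter K (A ∪ B) = anisotropicPerimeter K A + anisotropicPerimeter K B := by
  -- the cutoff
  set a' : ℝ := (2 * a + b) / 3 with ha'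
  set b' : ℝ := (a + 2 * b) / 3 with hb'
  have haa' : a < a' := by rw [ha']; linarith
  have ha'b' : a' < b' := by rw [ha', hb']; linarith
  have hb'b : b' < b := by rw [hb']; linarith
  have hd : 0 < b' - a' := sub_pos.2 ha'b'
  set θ : V → ℝ := fun x => Real.smoothTransition ((b' - ⟪x, m⟫) / (b' - a')) with hθ
  have hθC : ContDiff ℝ 1 θ := by
    refine Real.smoothTransition.contDiff.comp ?_
    exact ((contDiff_const.sub (contDiff_id.inner ℝ contDiff_const)).div_const _)
  have hθ01 : ∀ x, θ x ∈ Icc (0 : ℝ) 1 := fun x =>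
    ⟨Real.smoothTransition.nonneg _, Real.smoothTransition.le_one _⟩
  have hcont : Continuous fun x : V => ⟪x, m⟫ := continuous_id.inner continuous_const
  -- `θ = 1` on the open set `{⟪x, m⟫ < a'} ⊇ A`
  have hθA : ∀ x ∈ A, ∀ᶠ y in 𝓝 x, θ y = 1 := by
    intro x hx
    have hopen : IsOpen {y : V | ⟪y, m⟫ < a'} := isOpen_lt hcont continuous_const
    have hxmem : x ∈ {y : V | ⟪y, m⟫ < a'} := lt_of_le_of_lt (hAa x hx) haa'
    filter_upwards [hopen.mem_nhds hxmem] with y hy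
    refine Real.smoothTransition.one_of_one_le ?_
    rw [le_div_iff₀ hd, one_mul]
    have hy' : ⟪y, m⟫ < a' := hy
    linarith
  -- `θ = 0` on the open set `{b' < ⟪x, m⟫} ⊇ B`
  have hθB : ∀ x ∈ B, ∀ᶠ y in 𝓝 x, θ y = 0 := by
    intro x hx
    have hopen : IsOpen {y : V | b' < ⟪y, m⟫} := isOpen_lt continuous_const hcont
    have hxmem : x ∈ {y : V | b' < ⟪y, m⟫} := lt_of_lt_of_le hb'b (hBb x hx)
    filter_upwards [hopen.mem_nhds hxmem] with y hy
    refine Real.smoothTransition.zero_of_nonpos ?_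
    have hy' : b' < ⟪y, m⟫ := hy
    exact div_nonpos_of_nonpos_of_nonneg (by linarith) hd.le
  exact anisotropicPerimeter_union_eq_add_of_cutoff hK h0 hA hB hθC hθ01 hθA hθB

omit [MeasurableSpace V] [BorelSpace V] in
/-- **A `C¹` cutoff between sets at positive distance** (smooth Urysohn lemma on the
finite-dimensional space `V` regarded as a manifold): if `dist a b ≥ δ > 0` for all `a ∈ A`,
`b ∈ B`, there is `θ ∈ C¹(V; [0, 1])` with `θ = 1` near every point of `A` and `θ = 0` near every
point of `B`. [cite: Maggi2012, Theorem 16.3 (16.12) — plumbing] -/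
theorem exists_contDiff_cutoff_of_le_dist {A B : Set V} {δ : ℝ} (hδ : 0 < δ)
    (hAB : ∀ a ∈ A, ∀ b ∈ B, δ ≤ dist a b) :
    ∃ θ : V → ℝ, ContDiff ℝ 1 θ ∧ (∀ x, θ x ∈ Icc (0 : ℝ) 1) ∧
      (∀ x ∈ A, ∀ᶠ y in 𝓝 x, θ y = 1) ∧ (∀ x ∈ B, ∀ᶠ y in 𝓝 x, θ y = 0) := by
  have hδ2 : 0 < δ / 2 := by linarith
  -- `closure A ⊆ thickening (δ/2) A`, an open set missing the `δ/2`-balls around points of `B`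
  have hsub : closure A ⊆ interior (thickening (δ / 2) A) := by
    rw [(isOpen_thickening).interior_eq]
    exact closure_subset_thickening hδ2 A
  obtain ⟨f, hf1, hf0, hf01⟩ := exists_contMDiffMap_one_nhds_of_subset_interior
    (I := 𝓘(ℝ, V)) (M := V) (n := 1) isClosed_closure hsub
  refine ⟨f, f.contMDiff.contDiff, hf01, fun x hx => ?_, fun x hx => ?_⟩
  · exact (eventually_nhdsSet_iff_forall.1 hf1) x (subset_closure hx)
  · have hball : ball x (δ / 2) ∈ 𝓝 x := ball_mem_nhds x hδ2
    filter_upwards [hball] with y hy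
    refine hf0 y fun hyA => ?_
    rw [mem_thickening_iff] at hyA
    obtain ⟨a, haA, hya⟩ := hyA
    have h1 : δ ≤ dist a x := hAB a haA x hx
    have h2 : dist a x ≤ dist a y + dist y x := dist_triangle a y x
    rw [dist_comm a y] at h2
    have h3 : dist y x < δ / 2 := mem_ball.1 hy
    linarith

/-- **Additivity of the `K`-perimeter over sets at positive distance.** If `dist a b ≥ δ > 0` for all
`a ∈ A`, `b ∈ B` (measurable `A, B`, convex `K ∋ 0`), then `P_K(A ∪ B) = P_K(A) + P_K(B)`:
the `K`-weighted interface of two grains at positive distance is zero.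
[cite: Maggi2012, Theorem 16.3 (16.12); (20.2) p. 258] -/
theorem anisotropicPerimeter_union_eq_add_of_le_dist {K : Set V} (hK : Convex ℝ K)
    (h0 : (0 : V) ∈ K) {A B : Set V} (hA : MeasurableSet A) (hB : MeasurableSet B) {δ : ℝ}
    (hδ : 0 < δ) (hAB : ∀ a ∈ A, ∀ b ∈ B, δ ≤ dist a b) :
    anisotropicPerimeter K (A ∪ B) = anisotropicPerimeter K A + anisotropicPerimeter K B := by
  obtain ⟨θ, hθ, hθ01, hθA, hθB⟩ := exists_contDiff_cutoff_of_le_dist hδ hAB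
  exact anisotropicPerimeter_union_eq_add_of_cutoff hK h0 hA hB hθ hθ01 hθA hθB

/-- **Additivity of De Giorgi's perimeter over sets at positive distance**:
`Per(A ∪ B) = Per(A) + Per(B)` when `dist a b ≥ δ > 0` for all `a ∈ A`, `b ∈ B` (measurable `A, B`).
[cite: Maggi2012, Theorem 16.3 (16.12)] -/
theorem perimeter_union_eq_add_of_le_dist {A B : Set V} (hA : MeasurableSet A)
    (hB : MeasurableSet B) {δ : ℝ} (hδ : 0 < δ) (hAB : ∀ a ∈ A, ∀ b ∈ B, δ ≤ dist a b) :
    perimeter (A ∪ B) = perimeter A + perimeter B := by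
  rw [perimeter_eq_anisotropicPerimeter_closedBall, perimeter_eq_anisotropicPerimeter_closedBall,
    perimeter_eq_anisotropicPerimeter_closedBall]
  exact anisotropicPerimeter_union_eq_add_of_le_dist (convex_closedBall 0 1)
    (mem_closedBall_self zero_le_one) hA hB hδ hAB


/-! ### Sets with disjoint closures (API of crystal3d-full lit g8, p528312)

The following declarations restore, with their exact names and signatures, the interface landed by
the cell's literature seat in `p528312` (same target file; the two submissions raced and the
whole-file proposal `p528437` replaced it).  Hypothesis: `Disjoint (closure A) (closure B)` — for
unbounded sets this is weaker than a positive distance; the smooth Urysohn lemma (Mathlib's manifold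
partition of unity on the model space) still provides a cutoff equal to `0` near `closure B` and to
`1` near `closure A`, so `anisotropicPerimeter_union_eq_add_of_cutoff` applies. -/

omit [MeasurableSpace V] [BorelSpace V] in
/-- **Smooth Urysohn lemma with neighbourhoods** on the finite-dimensional space `V`: disjoint closed
sets `s, t` admit `χ ∈ C¹(V; [0, 1])` with `χ = 0` on a neighbourhood of `s` and `χ = 1` on a
neighbourhood of `t`. [cite: Maggi2012, Exercise 12.16 p. 125 — plumbing] -/
theorem exists_contDiff_zero_one_nhdsSet {s t : Set V} (hs : IsClosed s) (ht : IsClosed t)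
    (hd : Disjoint s t) :
    ∃ χ : V → ℝ, ContDiff ℝ 1 χ ∧ (∀ᶠ x in 𝓝ˢ s, χ x = 0) ∧ (∀ᶠ x in 𝓝ˢ t, χ x = 1) ∧
      ∀ x, χ x ∈ Icc (0 : ℝ) 1 := by
  obtain ⟨f, hf0, hf1, hf01⟩ := exists_contMDiffMap_zero_one_nhds_of_isClosed
    (I := 𝓘(ℝ, V)) (M := V) (n := 1) hs ht hd
  exact ⟨f, f.contMDiff.contDiff, hf0, hf1, hf01⟩

/-- **Glued lower bound** for sets with disjoint closures: for admissible `φ₁, φ₂` with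
`∫_A div φ₁ ≥ 0`, `∫_B div φ₂ ≥ 0`,
`ofReal (∫_A div φ₁) + ofReal (∫_B div φ₂) ≤ P_K(A ∪ B)` (`K` convex).
[cite: Maggi2012, Exercise 12.16 p. 125 (locality); (20.2) p. 258] -/
theorem ofReal_add_ofReal_le_anisotropicPerimeter_union {K : Set V} (hKc : Convex ℝ K)
    {A B : Set V} (hA : MeasurableSet A) (hB : MeasurableSet B)
    (hsep : Disjoint (closure A) (closure B)) {φ₁ φ₂ : V → V} (h₁ : ContDiff ℝ 1 φ₁)
    (hc₁ : HasCompactSupport φ₁) (hK₁ : ∀ x, φ₁ x ∈ K) (h₂ : ContDiff ℝ 1 φ₂)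
    (hc₂ : HasCompactSupport φ₂) (hK₂ : ∀ x, φ₂ x ∈ K) (hI₁ : 0 ≤ ∫ x in A, fieldDivergence φ₁ x)
    (hI₂ : 0 ≤ ∫ x in B, fieldDivergence φ₂ x) :
    ENNReal.ofReal (∫ x in A, fieldDivergence φ₁ x) + ENNReal.ofReal (∫ x in B, fieldDivergence φ₂ x)
      ≤ anisotropicPerimeter K (A ∪ B) := by
  obtain ⟨θ, hθ, hθB, hθA, hθ01⟩ := exists_contDiff_zero_one_nhdsSet isClosed_closure
    isClosed_closure hsep.symm
  have hθA' : ∀ x ∈ A, ∀ᶠ y in 𝓝 x, θ y = 1 := fun x hx =>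
    (eventually_nhdsSet_iff_forall.1 hθA) x (subset_closure hx)
  have hθB' : ∀ x ∈ B, ∀ᶠ y in 𝓝 x, θ y = 0 := fun x hx =>
    (eventually_nhdsSet_iff_forall.1 hθB) x (subset_closure hx)
  rw [← ENNReal.ofReal_add hI₁ hI₂,
    ← setIntegral_fieldDivergence_glue hA hB h₁ hc₁ h₂ hc₂ hθ hθA' hθB']
  exact le_anisotropicPerimeter (contDiff_glue h₁ h₂ hθ) (hasCompactSupport_glue θ hc₁ hc₂)
    (glue_mem hKc hK₁ hK₂ hθ01)

/-- **Additivity over sets with disjoint closures, `≥`**: `P_K(A) + P_K(B) ≤ P_K(A ∪ B)` for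
measurable `A, B` with `Disjoint (closure A) (closure B)` and convex `K ∋ 0`.
[cite: Maggi2012, Exercise 12.16 p. 125 (locality of perimeter); (20.2) p. 258] -/
theorem anisotropicPerimeter_add_le_union {K : Set V} (hKc : Convex ℝ K) (h0K : (0 : V) ∈ K)
    {A B : Set V} (hA : MeasurableSet A) (hB : MeasurableSet B)
    (hsep : Disjoint (closure A) (closure B)) :
    anisotropicPerimeter K A + anisotropicPerimeter K B ≤ anisotropicPerimeter K (A ∪ B) := by
  obtain ⟨θ, hθ, hθB, hθA, hθ01⟩ := exists_contDiff_zero_one_nhdsSet isClosed_closure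
    isClosed_closure hsep.symm
  have hθA' : ∀ x ∈ A, ∀ᶠ y in 𝓝 x, θ y = 1 := fun x hx =>
    (eventually_nhdsSet_iff_forall.1 hθA) x (subset_closure hx)
  have hθB' : ∀ x ∈ B, ∀ᶠ y in 𝓝 x, θ y = 0 := fun x hx =>
    (eventually_nhdsSet_iff_forall.1 hθB) x (subset_closure hx)
  exact (anisotropicPerimeter_union_eq_add_of_cutoff hKc h0K hA hB hθ hθ01 hθA' hθB').symm.le

/-- **Additivity of the `K`-perimeter over sets with disjoint closures**:
`P_K(A ∪ B) = P_K(A) + P_K(B)` for measurable `A, B` with `Disjoint (closure A) (closure B)` and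
convex `K ∋ 0`. [cite: Maggi2012, Exercise 12.16 p. 125 (locality of perimeter); (20.2) p. 258] -/
theorem anisotropicPerimeter_union_of_disjoint_closure {K : Set V} (hKc : Convex ℝ K)
    (h0K : (0 : V) ∈ K) {A B : Set V} (hA : MeasurableSet A) (hB : MeasurableSet B)
    (hsep : Disjoint (closure A) (closure B)) :
    anisotropicPerimeter K (A ∪ B) = anisotropicPerimeter K A + anisotropicPerimeter K B := by
  obtain ⟨θ, hθ, hθB, hθA, hθ01⟩ := exists_contDiff_zero_one_nhdsSet isClosed_closure
    isClosed_closure hsep.symm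
  have hθA' : ∀ x ∈ A, ∀ᶠ y in 𝓝 x, θ y = 1 := fun x hx =>
    (eventually_nhdsSet_iff_forall.1 hθA) x (subset_closure hx)
  have hθB' : ∀ x ∈ B, ∀ᶠ y in 𝓝 x, θ y = 0 := fun x hx =>
    (eventually_nhdsSet_iff_forall.1 hθB) x (subset_closure hx)
  exact anisotropicPerimeter_union_eq_add_of_cutoff hKc h0K hA hB hθ hθ01 hθA' hθB'

/-- **The interface term of grains with disjoint closures vanishes** (`ℝ≥0∞` form):
`P_K(A) + P_K(B) − P_K(A ∪ B) = 0`.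
[cite: Maggi2012, Exercise 12.16 p. 125; (20.2) p. 258] -/
theorem anisotropicPerimeter_add_sub_union_eq_zero {K : Set V} (hKc : Convex ℝ K)
    (h0K : (0 : V) ∈ K) {A B : Set V} (hA : MeasurableSet A) (hB : MeasurableSet B)
    (hsep : Disjoint (closure A) (closure B)) :
    anisotropicPerimeter K A + anisotropicPerimeter K B - anisotropicPerimeter K (A ∪ B) = 0 := by
  rw [anisotropicPerimeter_union_of_disjoint_closure hKc h0K hA hB hsep, tsub_self]

/-- **Additivity of De Giorgi's perimeter over sets with disjoint closures**:
`Per(A ∪ B) = Per(A) + Per(B)`. [cite: Maggi2012, Exercise 12.16 p. 125] -/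
theorem perimeter_union_of_disjoint_closure {A B : Set V} (hA : MeasurableSet A)
    (hB : MeasurableSet B) (hsep : Disjoint (closure A) (closure B)) :
    perimeter (A ∪ B) = perimeter A + perimeter B := by
  rw [perimeter_eq_anisotropicPerimeter_closedBall, perimeter_eq_anisotropicPerimeter_closedBall,
    perimeter_eq_anisotropicPerimeter_closedBall]
  exact anisotropicPerimeter_union_of_disjoint_closure (convex_closedBall 0 1)
    (mem_closedBall_self zero_le_one) hA hB hsep


/-! ### The same under the names of crystal3d-full lit g8's `p529135`, and locality -/

/-- **Additivity of the `K`-perimeter over sets with disjoint closures** (name and signature of the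
cell's literature seat, p529135): `P_K(A ∪ B) = P_K(A) + P_K(B)`.
[cite: Maggi2012, Theorem 16.3 (16.12); Exercise 12.16 p. 125; (20.2) p. 258] -/
theorem anisotropicPerimeter_union_eq_add_of_disjoint_closure {K : Set V} (hK : Convex ℝ K)
    (h0 : (0 : V) ∈ K) {A B : Set V} (hA : MeasurableSet A) (hB : MeasurableSet B)
    (hsep : Disjoint (closure A) (closure B)) :
    anisotropicPerimeter K (A ∪ B) = anisotropicPerimeter K A + anisotropicPerimeter K B :=
  anisotropicPerimeter_union_of_disjoint_closure hK h0 hA hB hsep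

/-- **Additivity of De Giorgi's perimeter over sets with disjoint closures** (name and signature of
p529135): `Per(A ∪ B) = Per(A) + Per(B)`. [cite: Maggi2012, Theorem 16.3 (16.12); Exercise 12.16 p. 125] -/
theorem perimeter_union_eq_add_of_disjoint_closure {A B : Set V} (hA : MeasurableSet A)
    (hB : MeasurableSet B) (hsep : Disjoint (closure A) (closure B)) :
    perimeter (A ∪ B) = perimeter A + perimeter B :=
  perimeter_union_of_disjoint_closure hA hB hsep

/-- **Locality of the `K`-perimeter** (name and signature of p529135): for measurable `A`, open
`U ⊇ closure A` and convex `K ∋ 0`, the supremum defining `P_K(A)` may be restricted to admissible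
fields with `tsupport φ ⊆ U` — multiply any admissible field by a cutoff `χ ∈ C¹(V; [0,1])`,
`χ = 1` near `closure A`, `χ = 0` near `Uᶜ` (`χ φ = χ φ + (1 − χ)·0 ∈ K` by convexity, and
`div (χ φ) = div φ` on `A`). [cite: Maggi2012, Exercise 12.16 p. 125 (locality of perimeter) and (12.6)] -/
theorem anisotropicPerimeter_eq_iSup_tsupport_subset {K : Set V} (hKc : Convex ℝ K)
    (h0K : (0 : V) ∈ K) {A U : Set V} (hA : MeasurableSet A) (hU : IsOpen U)
    (hAU : closure A ⊆ U) :
    anisotropicPerimeter K A = ⨆ (φ : V → V) (_ : ContDiff ℝ 1 φ ∧ HasCompactSupport φ ∧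
      (∀ x, φ x ∈ K) ∧ tsupport φ ⊆ U), ENNReal.ofReal (∫ x in A, fieldDivergence φ x) := by
  refine le_antisymm ?_ ?_
  · -- restrict an arbitrary admissible field to `U` with a cutoff
    refine anisotropicPerimeter_le_iff.2 fun φ h₁ h₂ h₃ => ?_
    obtain ⟨χ, hχ, hχ0, hχ1, hχ01⟩ := exists_contDiff_zero_one_nhdsSet hU.isClosed_compl
      isClosed_closure (disjoint_compl_left_iff.2 hAU)
    -- the cut-off field `χ φ = χ φ + (1 - χ) 0`
    set ψ : V → V := fun x => χ x • φ x + (1 - χ x) • (0 : V → V) x with hψ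
    have hψ₁ : ContDiff ℝ 1 ψ := contDiff_glue h₁ contDiff_const hχ
    have hψ₂ : HasCompactSupport ψ := hasCompactSupport_glue χ h₂ HasCompactSupport.zero
    have hψ₃ : ∀ x, ψ x ∈ K := glue_mem hKc h₃ (fun _ => h0K) hχ01
    have hψU : tsupport ψ ⊆ U := by
      -- `χ = 0` on an open set `W ⊇ Uᶜ`, so `support ψ ⊆ Wᶜ ⊆ U` with `Wᶜ` closed
      obtain ⟨W, hWo, hWU, hW0⟩ : ∃ W : Set V, IsOpen W ∧ Uᶜ ⊆ W ∧ ∀ x ∈ W, χ x = 0 := by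
        obtain ⟨W, hW, hWs⟩ := mem_nhdsSet_iff_exists.1 hχ0
        exact ⟨W, hW, hWs.1, fun x hx => hWs.2 hx⟩
      have hsupp : Function.support ψ ⊆ Wᶜ := by
        intro x hx
        by_contra hxW
        rw [Set.notMem_compl_iff] at hxW
        apply hx
        simp [hψ, hW0 x hxW]
      calc tsupport ψ = closure (Function.support ψ) := rfl
        _ ⊆ Wᶜ := closure_minimal hsupp hWo.isClosed_compl
        _ ⊆ U := by
          intro x hx
          by_contra hxU
          exact hx (hWU hxU)
    -- `div ψ = div φ` on `A`
    have hχA : ∀ x ∈ A, ∀ᶠ y in 𝓝 x, χ y = 1 := fun x hx =>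
      (eventually_nhdsSet_iff_forall.1 hχ1) x (subset_closure hx)
    have hint : ∫ x in A, fieldDivergence ψ x = ∫ x in A, fieldDivergence φ x := by
      refine setIntegral_congr_fun hA fun x hx => ?_
      apply fieldDivergence_congr_of_eventuallyEq
      filter_upwards [hχA x hx] with y hy
      simp [hψ, hy]
    rw [← hint]
    exact le_iSup₂ (f := fun (φ : V → V) (_ : ContDiff ℝ 1 φ ∧ HasCompactSupport φ ∧
      (∀ x, φ x ∈ K) ∧ tsupport φ ⊆ U) => ENNReal.ofReal (∫ x in A, fieldDivergence φ x))
      ψ ⟨hψ₁, hψ₂, hψ₃, hψU⟩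
  · exact iSup₂_le fun φ hφ => le_anisotropicPerimeter hφ.1 hφ.2.1 hφ.2.2.1

/-! ### Finite families: subadditivity and additivity over separated grains -/

section FiniteFamilies

variable {ι : Type*}

/-- **Finite subadditivity over pairwise disjoint sets**: for a finite family of pairwise disjoint
measurable sets, `P_K(⋃_{i ∈ s} A_i) ≤ Σ_{i ∈ s} P_K(A_i)` (all interface terms are `≥ 0`).
[cite: Maggi2012, (20.2) p. 258] -/
theorem anisotropicPerimeter_biUnion_le_sum (K : Set V) (s : Finset ι) {A : ι → Set V}
    (hA : ∀ i ∈ s, MeasurableSet (A i)) (hd : (s : Set ι).PairwiseDisjoint A) :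
    anisotropicPerimeter K (⋃ i ∈ s, A i) ≤ ∑ i ∈ s, anisotropicPerimeter K (A i) := by
  classical
  induction s using Finset.induction_on with
  | empty => simp [anisotropicPerimeter_of_volume_eq_zero]
  | @insert i s hi ih =>
    rw [Finset.set_biUnion_insert, Finset.sum_insert hi]
    have hA' : ∀ j ∈ s, MeasurableSet (A j) := fun j hj => hA j (Finset.mem_insert_of_mem hj)
    have hd' : (s : Set ι).PairwiseDisjoint A :=
      hd.subset (by simp [Finset.coe_insert, Set.subset_insert])
    have hdisj : Disjoint (A i) (⋃ j ∈ s, A j) := by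
      rw [Set.disjoint_iUnion₂_right]
      intro j hj
      exact hd (Finset.mem_insert_self i s) (Finset.mem_insert_of_mem hj)
        (fun h => hi (h ▸ hj))
    exact (anisotropicPerimeter_union_le K (Finset.measurableSet_biUnion s hA') hdisj).trans
      (add_le_add le_rfl (ih hA' hd'))

/-- Finite subadditivity of De Giorgi's perimeter over pairwise disjoint sets.
[cite: Maggi2012, (20.2) p. 258 with (12.2)] -/
theorem perimeter_biUnion_le_sum (s : Finset ι) {A : ι → Set V} (hA : ∀ i ∈ s, MeasurableSet (A i))
    (hd : (s : Set ι).PairwiseDisjoint A) :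
    perimeter (⋃ i ∈ s, A i) ≤ ∑ i ∈ s, perimeter (A i) := by
  simp only [perimeter_eq_anisotropicPerimeter_closedBall]
  exact anisotropicPerimeter_biUnion_le_sum _ s hA hd

/-- **Finite additivity over grains with pairwise disjoint closures** (`K` convex, `0 ∈ K`):
`P_K(⋃_{i ∈ s} A_i) = Σ_{i ∈ s} P_K(A_i)` — all interface terms vanish.
[cite: Maggi2012, Theorem 16.3 (16.12); Exercise 12.16 p. 125; (20.2) p. 258] -/
theorem anisotropicPerimeter_biUnion_eq_sum_of_disjoint_closure {K : Set V} (hK : Convex ℝ K)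
    (h0 : (0 : V) ∈ K) (s : Finset ι) {A : ι → Set V} (hA : ∀ i ∈ s, MeasurableSet (A i))
    (hd : (s : Set ι).Pairwise fun i j => Disjoint (closure (A i)) (closure (A j))) :
    anisotropicPerimeter K (⋃ i ∈ s, A i) = ∑ i ∈ s, anisotropicPerimeter K (A i) := by
  classical
  induction s using Finset.induction_on with
  | empty => simp [anisotropicPerimeter_of_volume_eq_zero]
  | @insert i s hi ih =>
    rw [Finset.set_biUnion_insert, Finset.sum_insert hi]
    have hA' : ∀ j ∈ s, MeasurableSet (A j) := fun j hj => hA j (Finset.mem_insert_of_mem hj)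
    have hd' : (s : Set ι).Pairwise fun i j => Disjoint (closure (A i)) (closure (A j)) :=
      hd.mono (by simp [Finset.coe_insert, Set.subset_insert])
    have hsep : Disjoint (closure (A i)) (closure (⋃ j ∈ s, A j)) := by
      have hfin : (⋃ j ∈ s, A j) = ⋃ j ∈ (s : Set ι), A j := by simp
      rw [hfin, (s.finite_toSet).closure_biUnion, Set.disjoint_iUnion₂_right]
      intro j hj
      exact hd (Finset.mem_insert_self i s) (Finset.mem_insert_of_mem hj) (fun h => hi (h ▸ hj))
    rw [anisotropicPerimeter_union_eq_add_of_disjoint_closure hK h0 (hA i (Finset.mem_insert_self i s))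
      (Finset.measurableSet_biUnion s hA') hsep, ih hA' hd']

/-- Finite additivity of De Giorgi's perimeter over sets with pairwise disjoint closures.
[cite: Maggi2012, Theorem 16.3 (16.12); Exercise 12.16 p. 125] -/
theorem perimeter_biUnion_eq_sum_of_disjoint_closure (s : Finset ι) {A : ι → Set V}
    (hA : ∀ i ∈ s, MeasurableSet (A i))
    (hd : (s : Set ι).Pairwise fun i j => Disjoint (closure (A i)) (closure (A j))) :
    perimeter (⋃ i ∈ s, A i) = ∑ i ∈ s, perimeter (A i) := by
  simp only [perimeter_eq_anisotropicPerimeter_closedBall]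
  exact anisotropicPerimeter_biUnion_eq_sum_of_disjoint_closure (convex_closedBall 0 1)
    (Metric.mem_closedBall_self zero_le_one) s hA hd

/-- `Fintype` form of `anisotropicPerimeter_biUnion_le_sum`: `P_K(⋃_i A_i) ≤ Σ_i P_K(A_i)`.
[cite: Maggi2012, (20.2) p. 258] -/
theorem anisotropicPerimeter_iUnion_le_sum [Fintype ι] (K : Set V) {A : ι → Set V}
    (hA : ∀ i, MeasurableSet (A i)) (hd : Pairwise fun i j => Disjoint (A i) (A j)) :
    anisotropicPerimeter K (⋃ i, A i) ≤ ∑ i, anisotropicPerimeter K (A i) := by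
  have h := anisotropicPerimeter_biUnion_le_sum K (Finset.univ : Finset ι) (fun i _ => hA i)
    (fun i _ j _ hij => hd hij)
  simpa using h

/-- `Fintype` form of `anisotropicPerimeter_biUnion_eq_sum_of_disjoint_closure`:
`P_K(⋃_i A_i) = Σ_i P_K(A_i)` for grains with pairwise disjoint closures.
[cite: Maggi2012, Theorem 16.3 (16.12); (20.2) p. 258] -/
theorem anisotropicPerimeter_iUnion_eq_sum_of_disjoint_closure [Fintype ι] {K : Set V}
    (hK : Convex ℝ K) (h0 : (0 : V) ∈ K) {A : ι → Set V} (hA : ∀ i, MeasurableSet (A i))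
    (hd : Pairwise fun i j => Disjoint (closure (A i)) (closure (A j))) :
    anisotropicPerimeter K (⋃ i, A i) = ∑ i, anisotropicPerimeter K (A i) := by
  have h := anisotropicPerimeter_biUnion_eq_sum_of_disjoint_closure hK h0 (Finset.univ : Finset ι)
    (fun i _ => hA i) (fun i _ j _ hij => hd hij)
  simpa using h

end FiniteFamilies

end Literature.Analysis.Convexity

end
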